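import Literature.Geometry.Riemannian.FamilyLaplacianRegularity
import Literature.Geometry.Riemannian.PerelmanNoncollapsingTransport
import Literature.Geometry.Riemannian.PerelmanEntropyDerivative
import HarnessLib

/-!
# Perelman's no local collapsing theorem from the conjugate heat flow and the POINTWISE entropy
# formula (Topping 2006, Prop. 8.2.6) on manifolds modelled on `ℝ^m`

`PerelmanEntropyDerivative.lean` reduces the monotonicity of `𝒲` along the coupled flow
((EF)(b)) to Topping's pointwise Prop. 8.2.6, `□* v = −2τ|Ric + Hess f − g/2τ|² u ≤ 0` for
`v = [τ(2Δf − |∇f|² + R) + f − n] u`, PLUS the joint smoothness of `v` on `M × [0, T']`. With the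
space-time regularity of the Laplacian and gradient of a smooth family
(`FamilyLaplacianRegularity.lean`) and of the scalar curvature of a Ricci flow
(`IsRicciFlow.contMDiffOn_scalarCurvatureWith`, `RicciFlowScalarCurvatureRegularity.lean`) the
smoothness of `v` is automatic for a smooth positive `u`; hence the named fact
`perelman_noLocalCollapsing` (`CanonicalNeighbourhoods.lean`; Perelman 2002, §4, Thm. 4.1) is
reduced to exactly two statements about closed manifolds modelled on `ℝ^m` carrying a Ricci
flow, both entering as explicit hypotheses (no definition, no named fact; NOT a discharge):

* `IsRicciFlow.contMDiffOn_conjugateHeatIntegrand` — for a Ricci flow on `[0, T']`, `T' > 0`,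
  `u > 0` smooth on `M × [0, T']` and `τ₀ > T'`, Topping's `v` (with
  `f = −log u − (n/2) log(4π(τ₀ − t))`) is `C^∞` on `M × [0, T']`;
* `IsRicciFlow.monotoneOn_wEntropy_of_pointwise` — **(EF)(b) from the pointwise inequality
  `□* v ≤ 0` alone**;
* `perelman_noLocalCollapsing_of_conjugateHeat_pointwise` — **the named fact follows from
  (CH) the backward solvability of `□* u = 0` from smooth positive final data and
  (P) the pointwise inequality `□* v ≤ 0` along its positive solutions** (Topping Prop. 8.2.6;
  Perelman (3.4) / Prop. 9.1, `v` as above), both only for closed manifolds modelled on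
  `EuclideanSpace ℝ (Fin m)` (`perelman_noLocalCollapsing_of_conjugateHeat_euclidean`).

## References

* G. Perelman, *The entropy formula for the Ricci flow and its geometric applications*,
  arXiv:math/0211159 (2002), §3.1, (3.3)–(3.4); §4, Thm. 4.1; §9, Prop. 9.1. [Perelman2002]
* P. Topping, *Lectures on the Ricci flow*, LMS Lecture Note Series 325, CUP 2006, §8.2,
  Prop. 8.2.1, Rem. 8.2.5, Prop. 8.2.6, Rem. 8.2.7; §8.3, Thm. 8.3.1. [Topping2006]
-/

noncomputable section

open Set Function Filter Manifold Bundle MeasureTheory Module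
open scoped Manifold ContDiff Topology ENNReal

namespace Literature.Geometry.Riemannian

open Lorentzian Lorentzian.PseudoRiemannianMetric

universe u v w

/-! ### Smoothness of Topping's `v` along a Ricci flow -/

section Regularity

variable {E : Type*} [NormedAddCommGroup E] [NormedSpace ℝ E] [FiniteDimensional ℝ E]
  [CompleteSpace E] {H : Type*} [TopologicalSpace H] {I : ModelWithCorners ℝ E H} [I.Boundaryless]
  {M : Type*} [TopologicalSpace M] [ChartedSpace H M] [IsManifold I ∞ M]
  {g : ℝ → PseudoRiemannianMetric I ∞ E (TangentSpace I : M → Type _)}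
  {cov : ℝ → CovariantDerivative I E (TangentSpace I : M → Type _)}

omit [FiniteDimensional ℝ E] [CompleteSpace E] [I.Boundaryless] [IsManifold I ∞ M] in
/-- A smooth function of time is smooth on `M × S` as a space-time function. [folklore] -/
theorem contMDiffOn_of_time {c : ℝ → ℝ} {S : Set ℝ} (hc : ContDiffOn ℝ ∞ c S) :
    ContMDiffOn (I.prod 𝓘(ℝ, ℝ)) 𝓘(ℝ, ℝ) ∞ (fun p : M × ℝ ↦ c p.2) (univ ×ˢ S) :=
  hc.contMDiffOn.comp contMDiffOn_snd fun _ hp ↦ hp.2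

omit [FiniteDimensional ℝ E] [CompleteSpace E] [I.Boundaryless] [IsManifold I ∞ M] in
/-- `−log u` is smooth on `M × S` for `u` smooth and positive there. [folklore] -/
theorem contMDiffOn_neg_log_prod {u : ℝ → M → ℝ} {S : Set ℝ} (hpos : ∀ t ∈ S, ∀ x, 0 < u t x)
    (hu : ContMDiffOn (I.prod 𝓘(ℝ, ℝ)) 𝓘(ℝ, ℝ) ∞ (fun p : M × ℝ ↦ u p.2 p.1) (univ ×ˢ S)) :
    ContMDiffOn (I.prod 𝓘(ℝ, ℝ)) 𝓘(ℝ, ℝ) ∞ (fun p : M × ℝ ↦ -Real.log (u p.2 p.1)) (univ ×ˢ S) := by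
  intro p hp
  have h := ContDiffAt.comp_contMDiffWithinAt (f := fun p : M × ℝ ↦ u p.2 p.1) (x := p)
    (Real.contDiffAt_log.2 (hpos p.2 hp.2 p.1).ne') (hu p hp)
  exact h.neg

/-- **Topping's `v` is smooth on space-time.** For a Ricci flow `(g, cov)` on `[0, T']`, `T' > 0`,
on a manifold with boundaryless model, `u > 0` smooth on `M × [0, T']`, and `τ₀ > T'`, the
function `v(t) = [(τ₀ − t)(2Δ_{g(t)} f(t) − |∇f(t)|²_{g(t)} + R(t)) + f(t) − n] u(t)`,
`f(t) = −log u(t) − (n/2) log(4π(τ₀ − t))` (Topping 2006, (8.2.3)) is `C^∞` on `M × [0, T']`: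
`f` is smooth, `Δ_{g(t)} f(t)` and `|∇f(t)|²` are smooth (`contMDiffOn_laplaceBeltrami`,
`contMDiffOn_gradSq` for the smooth family `g`), and `R` is smooth along the flow
(`IsRicciFlow.contMDiffOn_scalarCurvatureWith`). [cite: Topping2006, §8.2, (8.2.3) and §1.2.3] -/
theorem IsRicciFlow.contMDiffOn_conjugateHeatIntegrand {T' : ℝ} (hT' : 0 < T')
    (h : IsRicciFlow g cov (Icc 0 T')) {τ₀ : ℝ} (hτ₀ : T' < τ₀) {u : ℝ → M → ℝ}
    (hpos : ∀ t ∈ Icc 0 T', ∀ x, 0 < u t x)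
    (hu : ContMDiffOn (I.prod 𝓘(ℝ, ℝ)) 𝓘(ℝ, ℝ) ∞ (fun p : M × ℝ ↦ u p.2 p.1) (univ ×ˢ Icc 0 T'))
    (n : ℕ) :
    ContMDiffOn (I.prod 𝓘(ℝ, ℝ)) 𝓘(ℝ, ℝ) ∞ (fun p : M × ℝ ↦
      ((τ₀ - p.2) * (2 * (g p.2).laplaceBeltrami (fun y ↦ -Real.log (u p.2 y) -
          (n : ℝ) / 2 * Real.log (4 * Real.pi * (τ₀ - p.2))) p.1 -
          (g p.2).gradSq (fun y ↦ -Real.log (u p.2 y) -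
            (n : ℝ) / 2 * Real.log (4 * Real.pi * (τ₀ - p.2))) p.1 +
          (g p.2).scalarCurvatureWith (cov p.2) p.1) +
        (-Real.log (u p.2 p.1) - (n : ℝ) / 2 * Real.log (4 * Real.pi * (τ₀ - p.2))) - n) *
        u p.2 p.1) (univ ×ˢ Icc 0 T') := by
  have hS : UniqueDiffOn ℝ (Icc 0 T') := uniqueDiffOn_Icc hT'
  -- the potential `f(t) = -log u(t) - (n/2) log (4π(τ₀ - t))` as a space-time function
  have hc : ContDiffOn ℝ ∞ (fun t : ℝ ↦ (n : ℝ) / 2 * Real.log (4 * Real.pi * (τ₀ - t))) (Icc 0 T') := by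
    intro t ht
    have hpos' : 4 * Real.pi * (τ₀ - t) ≠ 0 := by
      have : 0 < τ₀ - t := by linarith [ht.2]
      positivity
    exact (contDiffAt_const.mul ((Real.contDiffAt_log.2 hpos').comp t
      (contDiffAt_const.mul (contDiffAt_const.sub contDiffAt_id)))).contDiffWithinAt
  have hfs : ContMDiffOn (I.prod 𝓘(ℝ, ℝ)) 𝓘(ℝ, ℝ) ∞ (fun p : M × ℝ ↦
      (fun (t : ℝ) (x : M) ↦ -Real.log (u t x) - (n : ℝ) / 2 * Real.log (4 * Real.pi * (τ₀ - t)))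
        p.2 p.1) (univ ×ˢ Icc 0 T') :=
    (contMDiffOn_neg_log_prod hpos hu).sub (contMDiffOn_of_time hc)
  -- the ingredients
  have hΔ := h.smooth.contMDiffOn_laplaceBeltrami hS
    (f := fun (t : ℝ) (x : M) ↦ -Real.log (u t x) - (n : ℝ) / 2 * Real.log (4 * Real.pi * (τ₀ - t)))
    hfs
  have hG := h.smooth.contMDiffOn_gradSq hS
    (f := fun (t : ℝ) (x : M) ↦ -Real.log (u t x) - (n : ℝ) / 2 * Real.log (4 * Real.pi * (τ₀ - t)))
    hfs
  have hR := h.contMDiffOn_scalarCurvatureWith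
  have hτ : ContMDiffOn (I.prod 𝓘(ℝ, ℝ)) 𝓘(ℝ, ℝ) ∞ (fun p : M × ℝ ↦ τ₀ - p.2) (univ ×ˢ Icc 0 T') :=
    contMDiffOn_of_time (contDiffOn_const.sub contDiffOn_id)
  refine (((hτ.mul ((((contMDiffOn_const (c := (2 : ℝ))).mul hΔ).sub hG).add hR)).add
    (hfs.sub (contMDiffOn_const (c := (n : ℝ))))).mul hu).congr fun p _ ↦ ?_
  simp only [Pi.mul_apply, Pi.add_apply]
  ring

end Regularity

/-! ### (EF)(b) from the pointwise inequality alone -/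

section Pointwise

variable {m : ℕ} {H : Type v} [TopologicalSpace H]
  {I : ModelWithCorners ℝ (EuclideanSpace ℝ (Fin m)) H} [I.Boundaryless]
  {M : Type w} [TopologicalSpace M] [ChartedSpace H M] [IsManifold I ∞ M]
  [T2Space M] [CompactSpace M] [MeasurableSpace M] [BorelSpace M]
  {g : ℝ → PseudoRiemannianMetric I ∞ (EuclideanSpace ℝ (Fin m)) (TangentSpace I : M → Type _)}
  {cov : ℝ → CovariantDerivative I (EuclideanSpace ℝ (Fin m)) (TangentSpace I : M → Type _)}

/-- **Monotonicity of `𝒲` along the coupled flow from the pointwise Prop. 8.2.6 alone** (Topping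
2006, Prop. 8.2.6 ⇒ Prop. 8.2.1; Perelman 2002, (3.4)): for a Ricci flow of Riemannian metrics on
`[0, T']`, `T' > 0`, on a closed manifold modelled on `ℝ^m`, `τ > 0`, and `u > 0` smooth on
`M × [0, T']`, IF Topping's `v = [(τ + T' − t)(2Δf − |∇f|² + R) + f − m] u`,
`f = −log u − (m/2) log(4π(τ + T' − t))`, satisfies `□* v = −∂ₜv − Δv + Rv ≤ 0` at every point,
THEN `t ↦ 𝒲(g(t), f(t), τ + T' − t)` is non-decreasing on `[0, T']` (hypothesis (EF)(b) of
`muEntropy_le_muEntropy_of_conjugateHeat`). The smoothness of `v` required by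
`monotoneOn_wEntropy_of_conjugateHeatOp_nonpos` is `contMDiffOn_conjugateHeatIntegrand`.
[cite: Topping2006, §8.2, Prop. 8.2.1 and Prop. 8.2.6] [cite: Perelman2002, §3.1, (3.4)] -/
theorem IsRicciFlow.monotoneOn_wEntropy_of_pointwise {T' : ℝ} (hT' : 0 < T')
    (h : IsRicciFlow g cov (Icc 0 T')) (hR : ∀ t ∈ Icc 0 T', (g t).IsRiemannian) {τ : ℝ}
    (hτ : 0 < τ) {u : ℝ → M → ℝ} (hpos : ∀ t ∈ Icc 0 T', ∀ x, 0 < u t x)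
    (hu : ContMDiffOn (I.prod 𝓘(ℝ, ℝ)) 𝓘(ℝ, ℝ) ∞ (fun p : M × ℝ ↦ u p.2 p.1) (univ ×ˢ Icc 0 T'))
    (hsub : ∀ t ∈ Icc 0 T', ∀ x,
      -derivWithin (fun s ↦
          ((τ + T' - s) * (2 * (g s).laplaceBeltrami (fun y ↦ -Real.log (u s y) -
              (m : ℝ) / 2 * Real.log (4 * Real.pi * (τ + T' - s))) x -
              (g s).gradSq (fun y ↦ -Real.log (u s y) -
                (m : ℝ) / 2 * Real.log (4 * Real.pi * (τ + T' - s))) x +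
              (g s).scalarCurvatureWith (cov s) x) +
            (-Real.log (u s x) - (m : ℝ) / 2 * Real.log (4 * Real.pi * (τ + T' - s))) - m) *
            u s x) (Icc 0 T') t -
        (g t).laplaceBeltrami (fun x ↦
          ((τ + T' - t) * (2 * (g t).laplaceBeltrami (fun y ↦ -Real.log (u t y) -
              (m : ℝ) / 2 * Real.log (4 * Real.pi * (τ + T' - t))) x -
              (g t).gradSq (fun y ↦ -Real.log (u t y) -
                (m : ℝ) / 2 * Real.log (4 * Real.pi * (τ + T' - t))) x +
              (g t).scalarCurvatureWith (cov t) x) +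
            (-Real.log (u t x) - (m : ℝ) / 2 * Real.log (4 * Real.pi * (τ + T' - t))) - m) *
            u t x) x +
        (g t).scalarCurvatureWith (cov t) x *
          (((τ + T' - t) * (2 * (g t).laplaceBeltrami (fun y ↦ -Real.log (u t y) -
              (m : ℝ) / 2 * Real.log (4 * Real.pi * (τ + T' - t))) x -
              (g t).gradSq (fun y ↦ -Real.log (u t y) -
                (m : ℝ) / 2 * Real.log (4 * Real.pi * (τ + T' - t))) x +
              (g t).scalarCurvatureWith (cov t) x) +
            (-Real.log (u t x) - (m : ℝ) / 2 * Real.log (4 * Real.pi * (τ + T' - t))) - m) *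
            u t x) ≤ 0) :
    MonotoneOn (fun t ↦ (g t).wEntropy (cov t)
      (fun x ↦ -Real.log (u t x) - (m : ℝ) / 2 * Real.log (4 * Real.pi * (τ + T' - t)))
      (τ + T' - t)) (Icc 0 T') := by
  have hm : (finrank ℝ (EuclideanSpace ℝ (Fin m)) : ℝ) = m := by simp
  have hv := h.contMDiffOn_conjugateHeatIntegrand hT' (τ₀ := τ + T') (by linarith) hpos hu m
  have key := h.monotoneOn_wEntropy_of_conjugateHeatOp_nonpos (convex_Icc 0 T') hR
    (τ₀ := τ + T') (fun t ht ↦ by linarith [ht.2]) hpos hu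
    (v := fun t x ↦ ((τ + T' - t) * (2 * (g t).laplaceBeltrami (fun y ↦ -Real.log (u t y) -
        (m : ℝ) / 2 * Real.log (4 * Real.pi * (τ + T' - t))) x -
        (g t).gradSq (fun y ↦ -Real.log (u t y) -
          (m : ℝ) / 2 * Real.log (4 * Real.pi * (τ + T' - t))) x +
        (g t).scalarCurvatureWith (cov t) x) +
      (-Real.log (u t x) - (m : ℝ) / 2 * Real.log (4 * Real.pi * (τ + T' - t))) - m) * u t x)
    (fun _ _ _ ↦ by rw [hm]) hv hsub
  rw [hm] at key
  exact key

end Pointwise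

/-! ### The named fact from (CH) and the pointwise inequality, on Euclidean models -/

/-- **Perelman's no local collapsing theorem I from the conjugate heat flow and the pointwise
entropy inequality on manifolds modelled on `ℝ^m`** (Perelman 2002, §3.1, (3.4), §9, Prop. 9.1
and §4, Thm. 4.1; Topping 2006, Rem. 8.2.5, Prop. 8.2.6, Prop. 8.2.1, (8.3.10), Thm. 8.3.1). Over
all closed manifolds modelled on `EuclideanSpace ℝ (Fin m)` (all `m`) carrying a Ricci flow of
Riemannian metrics `(g, cov)` on `[0, T)`, and all `0 < t₀ < T`:
* `hCH` (**backward solvability of `□* u = 0`**, Topping Rem. 8.2.5 / (6.4.8)): every smooth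
  positive `u₁` is the value at `t₀` of a positive `u`, `C^∞` on `M × [0, t₀]`, solving
  `∂ₜu = −Δ_{g(t)}u + Ru` on `[0, t₀]`;
* `hP` (**Topping's Prop. 8.2.6 as an inequality**, `□* v ≤ 0` — in print
  `□* v = −2τ|Ric + Hess f − g/2τ|² u`): along every such `u` and for every `τ > 0`, the function
  `v = [(τ + t₀ − t)(2Δf − |∇f|² + R) + f − m] u`, `f = −log u − (m/2) log(4π(τ + t₀ − t))`,
  satisfies `−∂ₜv − Δ_{g(t)} v + R v ≤ 0` at every `(x, t)`, `t ∈ [0, t₀]`.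
Conclusion: `perelman_noLocalCollapsing` (every model space, via the transport
`perelman_noLocalCollapsing_of_conjugateHeat_euclidean`). NOT a discharge of the named fact: (CH)
is linear parabolic existence theory on closed manifolds and (P) is Perelman's computation
(Bochner formula, contracted Bianchi identity, evolution of `R`, `|∇f|²`, `Δf` under the flow),
neither of which is in Mathlib or the tree.
[cite: Perelman2002, §3.1, (3.4); §4, Thm. 4.1] [cite: Topping2006, §8.2, Prop. 8.2.6, Rem. 8.2.5; §8.3, Thm. 8.3.1] -/
theorem perelman_noLocalCollapsing_of_conjugateHeat_pointwise
    (hCH : ∀ (m : ℕ) {H : Type v} [TopologicalSpace H]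
      (I : ModelWithCorners ℝ (EuclideanSpace ℝ (Fin m)) H) [I.Boundaryless]
      (M : Type w) [TopologicalSpace M] [T2Space M] [SecondCountableTopology M] [CompactSpace M]
      [ChartedSpace H M] [IsManifold I ∞ M] [MeasurableSpace M] [BorelSpace M] (T : ℝ), 0 < T →
      ∀ (g : ℝ → PseudoRiemannianMetric I ∞ (EuclideanSpace ℝ (Fin m)) (TangentSpace I : M → Type _))
        (cov : ℝ → CovariantDerivative I (EuclideanSpace ℝ (Fin m)) (TangentSpace I : M → Type _)),
        IsRicciFlow g cov (Ico 0 T) → (∀ t ∈ Ico 0 T, (g t).IsRiemannian) →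
        ∀ t₀ ∈ Ioo 0 T, ∀ u₁ : M → ℝ, ContMDiff I 𝓘(ℝ, ℝ) ∞ u₁ → (∀ x, 0 < u₁ x) →
          ∃ u : ℝ → M → ℝ, u t₀ = u₁ ∧ (∀ t ∈ Icc 0 t₀, ∀ x, 0 < u t x) ∧
            ContMDiffOn (I.prod 𝓘(ℝ, ℝ)) 𝓘(ℝ, ℝ) ∞ (fun p : M × ℝ ↦ u p.2 p.1)
              (univ ×ˢ Icc 0 t₀) ∧
            ∀ t ∈ Icc 0 t₀, ∀ x, derivWithin (fun s ↦ u s x) (Icc 0 t₀) t =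
              -(g t).laplaceBeltrami (u t) x + (g t).scalarCurvatureWith (cov t) x * u t x)
    (hP : ∀ (m : ℕ) {H : Type v} [TopologicalSpace H]
      (I : ModelWithCorners ℝ (EuclideanSpace ℝ (Fin m)) H) [I.Boundaryless]
      (M : Type w) [TopologicalSpace M] [T2Space M] [SecondCountableTopology M] [CompactSpace M]
      [ChartedSpace H M] [IsManifold I ∞ M] [MeasurableSpace M] [BorelSpace M] (T : ℝ), 0 < T →
      ∀ (g : ℝ → PseudoRiemannianMetric I ∞ (EuclideanSpace ℝ (Fin m)) (TangentSpace I : M → Type _))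
        (cov : ℝ → CovariantDerivative I (EuclideanSpace ℝ (Fin m)) (TangentSpace I : M → Type _)),
        IsRicciFlow g cov (Ico 0 T) → (∀ t ∈ Ico 0 T, (g t).IsRiemannian) →
        ∀ t₀ ∈ Ioo 0 T, ∀ u : ℝ → M → ℝ, (∀ t ∈ Icc 0 t₀, ∀ x, 0 < u t x) →
          ContMDiffOn (I.prod 𝓘(ℝ, ℝ)) 𝓘(ℝ, ℝ) ∞ (fun p : M × ℝ ↦ u p.2 p.1)
            (univ ×ˢ Icc 0 t₀) →
          (∀ t ∈ Icc 0 t₀, ∀ x, derivWithin (fun s ↦ u s x) (Icc 0 t₀) t =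
            -(g t).laplaceBeltrami (u t) x + (g t).scalarCurvatureWith (cov t) x * u t x) →
          ∀ τ : ℝ, 0 < τ → ∀ t ∈ Icc 0 t₀, ∀ x,
            -derivWithin (fun s ↦
                ((τ + t₀ - s) * (2 * (g s).laplaceBeltrami (fun y ↦ -Real.log (u s y) -
                    (m : ℝ) / 2 * Real.log (4 * Real.pi * (τ + t₀ - s))) x -
                    (g s).gradSq (fun y ↦ -Real.log (u s y) -
                      (m : ℝ) / 2 * Real.log (4 * Real.pi * (τ + t₀ - s))) x +
                    (g s).scalarCurvatureWith (cov s) x) +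
                  (-Real.log (u s x) - (m : ℝ) / 2 * Real.log (4 * Real.pi * (τ + t₀ - s))) - m) *
                  u s x) (Icc 0 t₀) t -
              (g t).laplaceBeltrami (fun x ↦
                ((τ + t₀ - t) * (2 * (g t).laplaceBeltrami (fun y ↦ -Real.log (u t y) -
                    (m : ℝ) / 2 * Real.log (4 * Real.pi * (τ + t₀ - t))) x -
                    (g t).gradSq (fun y ↦ -Real.log (u t y) -
                      (m : ℝ) / 2 * Real.log (4 * Real.pi * (τ + t₀ - t))) x +
                    (g t).scalarCurvatureWith (cov t) x) +
                  (-Real.log (u t x) - (m : ℝ) / 2 * Real.log (4 * Real.pi * (τ + t₀ - t))) - m) *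
                  u t x) x +
              (g t).scalarCurvatureWith (cov t) x *
                (((τ + t₀ - t) * (2 * (g t).laplaceBeltrami (fun y ↦ -Real.log (u t y) -
                    (m : ℝ) / 2 * Real.log (4 * Real.pi * (τ + t₀ - t))) x -
                    (g t).gradSq (fun y ↦ -Real.log (u t y) -
                      (m : ℝ) / 2 * Real.log (4 * Real.pi * (τ + t₀ - t))) x +
                    (g t).scalarCurvatureWith (cov t) x) +
                  (-Real.log (u t x) - (m : ℝ) / 2 * Real.log (4 * Real.pi * (τ + t₀ - t))) - m) *
                  u t x) ≤ 0) :
    perelman_noLocalCollapsing.{u, v, w} :=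
  perelman_noLocalCollapsing_of_conjugateHeat_euclidean hCH
    fun m _H _ I _ M _ _ _ _ _ _ _ _ T hT g cov hflow hRiem t₀ ht₀ u hpos hu hpde τ hτ ↦
      (hflow.mono (fun _ ht ↦ ⟨ht.1, ht.2.trans_lt ht₀.2⟩)).monotoneOn_wEntropy_of_pointwise ht₀.1
        (fun t ht ↦ hRiem t ⟨ht.1, ht.2.trans_lt ht₀.2⟩) hτ hpos hu
        (hP m I M T hT g cov hflow hRiem t₀ ht₀ u hpos hu hpde τ hτ)

end Literature.Geometry.Riemannian

end
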